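import Summits.AnomalousDissipation.AnomalousDissipation.Theorems.RelaxingFamily.Negative.LinearEnstrophyBudget
import HarnessLib

/-!
# Crux `RelaxingFamily` (stmt-AnomalousDissipation-15009) — ideator 4, round 2: typed ROUTE-LEVEL input

This seat files NO positive crux idea (see `BarrierNotesIdeator4R2.md`: every lever examined reduces to
the crux or dies by a budget law). What it types instead is the one decision-relevant fact for the
route's tenure planner, who must choose between (i) weakening (U_h) and (ii) running r3 as a refutation
track:

* `RelaxesUnderMajorant`, `MajorantFamilyUnder Hyp` — the crux with the exponential envelope
  `C e^{-γ t}` replaced by an ARBITRARY phase-uniform, level-uniform majorant `m(t) → 0`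
  (this is the weakest "uniform release majorant" shape; `RelaxationBoundsInventory`-type glue consumes
  any integrable one).
* `majorantFamilyUnder_of_relaxingFamilyUnder` (PROVED): the crux implies its majorant form, class by class.
* `Seis2022_window_L2` (NAMED FACT, NOT PROVED HERE): the window form of Seis 2022, Thm 2 / Rmk 1 —
  reduction of `‖θ‖₂` below a profile-dependent threshold on ONE unit window `(t⋆, t⋆+1)` already costs
  `log(1/κ) ≤ K (1 + t⋆)` under a slope-`M` gradient budget. It is the in-tree `seis_core`
  (`Literature/Analysis/FluidPDE/SeisDissipationRateBoundProofs.lean`) run with horizon `T := t⋆ + 2`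
  and the "brutal" upper-endpoint estimate fed by the window smallness instead of `C₀ e^{-N}`; size M.
* `MajorantSeisFloor` (TARGET): `Seis2022_window_L2 → ¬ MajorantFamilyUnder LinearEnstrophyBudget` —
  same glue as the landed `relaxingFamily_false_without_superlinearEnstrophy` (p97152).

READING FOR THE ROUTE: weakening (U_h) from `C e^{-γt}` to ANY uniform majorant tending to zero
(algebraic, merely "halved by a fixed time from every phase", …) is squeezed by exactly the same Seis
floor — windowed mean `‖∇v_j‖₂ ≳ log(1/ν_j)/(1+t⋆)` from every phase at bounded energy — so no
intermediate weakening of r3/r2 escapes the round-1 verdict; the first shape that does is the INVENTORY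
form without any uniform release majorant, i.e. TwoAndHalfD's crux 0448. (Planner
planner-cruxidea-stmt-AnomalousDissipation-15009-4-0, 2026-08-16.)
-/

noncomputable section

open MeasureTheory Set Filter Function TopologicalSpace Topology
open scoped ENNReal NNReal InnerProductSpace

namespace Summit.AnomalousDissipation.AnomalousDissipation.Cruxes.RelaxingFamily.SketchIdeator4

set_option linter.dupNamespace false

open Literature.Analysis.FunctionSpaces Literature.Analysis.FunctionSpaces.Torus
open Literature.Analysis.FluidPDE Literature.Analysis.FluidPDE.Torus
open Summit.AnomalousDissipation.AnomalousDissipation.Theses.LimitingAbsorption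
open Summit.AnomalousDissipation.AnomalousDissipation.Theorems.RelaxingFamily.Negative

/-- The unit flat 2-torus (local notation). -/
local notation "𝕋²" => UnitAddTorus (Fin 2)
/-- Planar vectors (local notation). -/
local notation "E²" => EuclideanSpace ℝ (Fin 2)

/-! ## The majorant-weakened relaxation clause -/

/-- (U_h^m): phase-uniform, level-uniform relaxation of the profile `h` under a MAJORANT `m`:
`‖θ(t)‖² ≤ m(t) ‖h‖²` for a.e. `t`, every level `j`, every phase `s ≥ 0`, every weak solution.
With `m t = C e^{-γ t}` this is `RelaxesUniformly ν v h C γ` verbatim. -/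
def RelaxesUnderMajorant (ν : ℕ → ℝ) (v : ℕ → ℝ → 𝕋² → E²) (h : 𝕋² → ℝ) (m : ℝ → ℝ) : Prop :=
  ∀ (j : ℕ) (s : ℝ), 0 ≤ s → ∀ (T : ℝ) (θ : ℝ → 𝕋² → ℝ),
    IsWeakScalarTransportOn T (ν j) (fun t => v j (s + t)) h θ →
      ∀ᵐ t ∂(volume.restrict (Ioo (0 : ℝ) T)), scalarL2Sq (θ t) ≤ m t * scalarL2Sq h

/-- The crux `RelaxingFamily` under an extra hypothesis `Hyp`, with the exponential envelope replaced by
an arbitrary uniform majorant `m → 0` (same witness data as `RelaxingFamilyUnder Hyp`). -/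
def MajorantFamilyUnder
    (Hyp : (𝕋² → E²) → (𝕋² → ℝ) → (ℕ → ℝ) → (ℕ → ℝ → 𝕋² → E²) → Prop) : Prop :=
  ∃ (g : 𝕋² → E²) (h : 𝕋² → ℝ), IsSmooth g ∧ IsDivFree g ∧ HasZeroMean g ∧
    IsSmooth h ∧ HasZeroMean h ∧ h ≠ 0 ∧
    ∃ (ν : ℕ → ℝ) (v₀ : ℕ → 𝕋² → E²) (v : ℕ → ℝ → 𝕋² → E²),
      (∀ j, 0 < ν j) ∧ Tendsto ν atTop (𝓝 0) ∧
      (∀ j, IsGlobalLerayHopf (ν j) (fun _ => g) (v₀ j) (v j)) ∧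
      (∀ j (T : ℝ), 0 < T →
        MemLp (stLift (v j)) ⊤ (volume.restrict (Ioo (0 : ℝ) T ×ˢ univ))) ∧
      (∃ E : ℝ, ∀ j, meanEnergy (v j) ≤ E) ∧
      Hyp g h ν v ∧
      ∃ m : ℝ → ℝ, Tendsto m atTop (𝓝 0) ∧ RelaxesUnderMajorant ν v h m

/-- The crux (under any extra hypothesis) implies its majorant form with `m t = C e^{-γ t}`. [folklore] -/
theorem majorantFamilyUnder_of_relaxingFamilyUnder
    {Hyp : (𝕋² → E²) → (𝕋² → ℝ) → (ℕ → ℝ) → (ℕ → ℝ → 𝕋² → E²) → Prop}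
    (h1 : RelaxingFamilyUnder Hyp) : MajorantFamilyUnder Hyp := by
  obtain ⟨g, h, hg, hgd, hgm, hh, hhm, hh0, ν, v₀, v, hν, hνlim, hLH, hbd, hE, hH, C, γ, _hC, hγ,
    hrelax⟩ := h1
  refine ⟨g, h, hg, hgd, hgm, hh, hhm, hh0, ν, v₀, v, hν, hνlim, hLH, hbd, hE, hH,
    fun t => C * Real.exp (-(γ * t)), ?_, ?_⟩
  · have h1 : Tendsto (fun t : ℝ => Real.exp (-(γ * t))) atTop (𝓝 0) :=
      Real.tendsto_exp_neg_atTop_nhds_zero.comp (tendsto_id.const_mul_atTop hγ)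
    simpa using h1.const_mul C
  · intro j s hs T θ hθ
    exact hrelax j s hs T θ hθ

/-- In particular the crux itself implies the majorant form with the trivial extra hypothesis. -/
theorem majorantFamily_of_relaxingFamily (hW : RelaxingFamily) :
    MajorantFamilyUnder (fun _ _ _ _ => True) :=
  majorantFamilyUnder_of_relaxingFamilyUnder (relaxingFamilyUnder_true_iff.2 hW)

/-- Monotonicity of `MajorantFamilyUnder` in the extra hypothesis. [folklore] -/
theorem MajorantFamilyUnder.mono
    {H₁ H₂ : (𝕋² → E²) → (𝕋² → ℝ) → (ℕ → ℝ) → (ℕ → ℝ → 𝕋² → E²) → Prop}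
    (h12 : ∀ g h ν v, H₁ g h ν v → H₂ g h ν v) (h1 : MajorantFamilyUnder H₁) :
    MajorantFamilyUnder H₂ := by
  obtain ⟨g, h, hg, hgd, hgm, hh, hhm, hh0, ν, v₀, v, hν, hνlim, hLH, hbd, hE, hH, hrest⟩ := h1
  exact ⟨g, h, hg, hgd, hgm, hh, hhm, hh0, ν, v₀, v, hν, hνlim, hLH, hbd, hE, h12 _ _ _ _ hH, hrest⟩

/-! ## The window form of Seis' bound (named fact; NOT proved in this sketch) -/

/-- **Seis 2022, window form (case `p = q = r = 2`)** — UNPROVED NAMED STATEMENT (this seat's reading of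
the in-tree proof `seis_core`, `SeisDissipationRateBoundProofs.lean`, with horizon `T := t⋆ + 2`).
For profile data `(a, b, B)` and a budget slope `M` there are `κ₀ ∈ (0,1)`, a smallness threshold
`η > 0` and `K ≥ 0` such that: if `κ ≤ κ₀`, the drift has essentially bounded energy and the linear
windowed gradient budget `∫₀ᵗ ‖∇u‖₂ ≤ M (1+t)`, the datum is smooth, mean-zero with
`a ≤ ‖θ₀‖₁ ≤ b`, `‖∇θ₀‖₁ ≤ B`, `θ` is a weak solution on every horizon, and `‖θ(t)‖₂ ≤ η` for a.e. `t`
in ONE unit window `(t⋆, t⋆ + 1)`, then `log(1/κ) ≤ K (1 + t⋆)`.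
(Seis' Thm 2 / Rmk 1 is the special case in which the window is supplied by `C₀ e^{-Dt}`; the proof
uses the exponential only to locate such a window at `t⋆ ≍ N/D`.) [cite: Seis2022, proof of Thm 2, §2.2 (arXiv:2003.08794 pp. 7–8)] -/
def Seis2022_window_L2 : Prop :=
  ∀ {d : Type} [Fintype d] [DecidableEq d] (a b B M : ℝ), 0 < a → 0 ≤ M →
    ∃ κ₀ η K : ℝ, 0 < κ₀ ∧ κ₀ < 1 ∧ 0 < η ∧ 0 ≤ K ∧
      ∀ (κ tStar : ℝ) (u : ℝ → UnitAddTorus d → EuclideanSpace ℝ d) (θ₀ : UnitAddTorus d → ℝ)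
        (θ : ℝ → UnitAddTorus d → ℝ),
        0 < κ → κ ≤ κ₀ → 0 < tStar →
        (∃ M' : ℝ≥0, ∀ᵐ t ∂(volume.restrict (Ioi (0 : ℝ))), ∫⁻ x, ‖u t x‖ₑ ^ 2 ≤ M') →
        (∀ t : ℝ, 0 < t →
            ∫⁻ τ in Ioo 0 t, eGradNormSq (u τ) ^ (1 / 2 : ℝ) ≤ ENNReal.ofReal (M * (1 + t))) →
        IsSmooth θ₀ → HasZeroMean θ₀ →
        a ≤ ∫ x, |θ₀ x| → ∫ x, |θ₀ x| ≤ b →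
        ∫ x, ‖Torus.gradient θ₀ x‖ ≤ B →
        (∀ T : ℝ, 0 < T → IsWeakScalarTransportOn T κ u θ₀ θ) →
        (∀ᵐ t ∂(volume.restrict (Ioo tStar (tStar + 1))), scalarL2Sq (θ t) ≤ η ^ 2) →
        Real.log κ⁻¹ ≤ K * (1 + tStar)

/-! ## The target for the disprover / the reading for the tenure planner -/

/-- **TARGET (`_false_without_` shape for the majorant-weakened crux).** From the window form of Seis'
bound, NO uniform majorant `m → 0` — exponential or not — is compatible with a `j`-uniform linear
windowed enstrophy budget from some phase: pick `t⋆` with `m ≤ η²/‖h‖₂²` on `[t⋆, ∞)` (`m → 0`), then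
the level `j` with `ν_j ≤ κ₀` and `log(1/ν_j) > K(1+t⋆)`; glue a global weak release at the budget
phase `s_j` (`exists_global_isWeakScalarTransportOn`, as in p97152) and contradict `Seis2022_window_L2`.
Consequence for the route: every weakening of (U_h) that keeps SOME phase-uniform `ν`-uniform majorant
inherits the full Seis squeeze (windowed mean `‖∇v_j‖₂ ≳ log(1/ν_j)/(1+t⋆)` from every phase at
bounded energy); only the inventory form (no uniform release majorant; TwoAndHalfD 0448) escapes. -/
def MajorantSeisFloor : Prop :=
  Seis2022_window_L2 → ¬ MajorantFamilyUnder LinearEnstrophyBudget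

/-- Sanity (the exponential instance of the target is the landed theorem): the majorant target implies
the landed `relaxingFamily_false_without_superlinearEnstrophy`-shape statement. [folklore] -/
theorem relaxingFamily_false_without_superlinearEnstrophy_of_majorantSeisFloor
    (hT : MajorantSeisFloor) (hS : Seis2022_window_L2) :
    ¬ RelaxingFamilyUnder LinearEnstrophyBudget := fun hW =>
  hT hS (majorantFamilyUnder_of_relaxingFamilyUnder hW)

end Summit.AnomalousDissipation.AnomalousDissipation.Cruxes.RelaxingFamily.SketchIdeator4

end
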